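import Mathlib
import HarnessLib

/-!
# Adaptive PT-MetaD without re-equilibration is NOT exact in the measurement stream: two-state witnesses

HONEST FRAMING: exact (Metropolis-corrected) sampling algorithms for lattice gauge theory;
figures of merit are autocorrelation/cost numbers at stated couplings and volumes; no
continuum-physics claim.

Venture `LatticeQCDFlow` (cell pub-lqcd), topic `Exactness`; FANOUT row 22 (`su3-ptbc`), PT-MetaD
arm E5 (HOME `su3-ptbc/CARD-su3-ptbc.md` §6).  Companion of `PTMetaDSwap.lean` (static bias: the
measurement stream is exact) and `PTMetaDAdaptiveRedraw.lean` (bias updated between swaps: exact at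
every time PROVIDED the biased stream is redrawn from its law at the current bias after each update
and before the exchange).  This file shows, by explicit finite computation, that the proviso cannot
be dropped: NEW WORK of the cell, elementary (finite sums over `Bool`, exact rational arithmetic);
nothing is cited as a fact.  KNOWN MECHANISM, named only: adaptive Monte Carlo with a
state-dependent adaptation loses the target law at finite times (Roberts–Rosenthal, J. Appl. Prob. 44
(2007) 458); for a single metadynamics stream with a dynamic bias «different reweighting schemes
have been put forward» (arXiv:2307.04742 §II) — the point typed here is that the MEASUREMENT stream
of the pair inherits the defect through the exchange step.

## The two-sector toy (everything an elementary move of PT-MetaD)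

Configurations = two topological sectors `Bool`; physical law `phys = (1/3, 2/3)` (`false`, `true`);
the measurement stream is FROZEN between exchanges (identity update — exact; the regime PT-MetaD is
built for: local updates do not tunnel); the bias is a deposit count `V : Bool → ℕ` with deposit
weight `w = log 2`, so the biased stream's weight is `biasW V b = phys b · 2^{−V b}`; a metadynamics
update deposits at the biased stream's current sector (`deposit`); the exchange at bias `V` is the
Metropolis swap `swapK V` with acceptance `swapAcc V x y = min {1, 2^{V y − V x}}`
(`= min {1, e^{w (V y − V x)}}`, the test of `PTMetaDSwap.involAccept_ptMetaD` /
`PTMetaDAdaptiveRedraw.involAccept_adaptive`).  CERTIFICATES that every move is exact for its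
instantaneous target: `swapK_detailedBalance` (w.r.t. `phys x · biasW V y`, every `V`),
`flipMH_detailedBalance` (one Metropolis move of the biased stream, w.r.t. `biasW V`, every `V`),
`heatBath_stationary` (independent redraw from the normalised biased law), `swapK_sum` / `flipMH_sum` /
`heatBath_sum` (Markov); the initial law is `phys ⊗ phys = phys ⊗ (biased law at V = 0)`.

## Results (the measurement stream's law of `x` after the stated rounds, exact rationals)

* **`witnessMetropolis`** — protocol «deposit → ONE exact Metropolis move of the biased stream at
  the new bias → exchange at the new bias» (the biased stream is updated exactly but NOT
  re-equilibrated): after ONE round `P(x₁ = false) = 1/2 ≠ 1/3 = phys false`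
  (`roundMetropolis_false`).
* **`witnessMetaDOrder`** — protocol «exact heat-bath redraw of the biased stream at the current
  bias → deposit at the redrawn sector → exchange at the NEW bias» (the literal metadynamics order:
  the bias used in the test has been updated AFTER the equilibration): round one is still exact
  (`roundOneMetaDOrder_false = 1/3`) but after TWO rounds `P(x₂ = false) = 2/5 ≠ 1/3`
  (`roundTwoMetaDOrder_false`).
* `roundTwoRedrawOrder_false = 1/3` — sanity instance of `PTMetaDAdaptiveRedraw`: «deposit → exact
  redraw at the new bias → exchange» is exact (here checked for two rounds by the same arithmetic).

So «the measurement stream samples the physical distribution, no reweighting is needed» is a theorem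
for a STATIC bias (and for the idealised redraw protocol), and false as stated during bias build-up.
NOT CLAIMED: the size of the defect for realistic deposit weights (here `w = log 2` is huge), its
decay when the bias converges, or anything about the published runs.
-/

noncomputable section

namespace Summit.Ventures.LatticeQCDFlow.Exactness

namespace PTMetaDWitness

open Finset

/-! ## §1 The toy: physical law, bias, elementary moves -/

/-- The physical law of the two sectors: `phys false = 1/3`, `phys true = 2/3`. -/
def phys (b : Bool) : ℝ := if b then 2 / 3 else 1 / 3

/-- `e^{w V(b)} = 2^{V b}`: the inverse Boltzmann factor of the bias (`w = log 2` per deposit). -/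
def biasExp (V : Bool → ℕ) (b : Bool) : ℝ := (2 : ℝ) ^ (V b)

/-- The biased stream's un-normalised weight at bias `V`: `phys b · e^{−w V b} = phys b / 2^{V b}`. -/
def biasW (V : Bool → ℕ) (b : Bool) : ℝ := phys b / biasExp V b

/-- No bias. -/
def noBias : Bool → ℕ := fun _ => 0

/-- **Metadynamics update**: deposit one unit of bias at the sector `s` currently held by the biased
stream. -/
def deposit (V : Bool → ℕ) (s : Bool) : Bool → ℕ := fun b => if b = s then V b + 1 else V b

/-- **Exchange acceptance at bias `V`** (measurement stream holds `x`, biased stream holds `y`):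
`min {1, e^{w (V y − V x)}} = min {1, 2^{V y} / 2^{V x}}` — the physical action has cancelled. -/
def swapAcc (V : Bool → ℕ) (x y : Bool) : ℝ := min 1 (biasExp V y / biasExp V x)

/-- **The exchange kernel** on pairs `(x, y)`: move to `(y, x)` with probability `swapAcc`, else stay. -/
def swapK (V : Bool → ℕ) (z z' : Bool × Bool) : ℝ :=
  (if z' = z.swap then swapAcc V z.1 z.2 else 0) + (if z' = z then 1 - swapAcc V z.1 z.2 else 0)

/-- **One Metropolis move of the biased stream at bias `V`**: propose the other sector, accept with
`min {1, biasW V (¬y) / biasW V y}`. -/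
def flipMH (V : Bool → ℕ) (y y' : Bool) : ℝ :=
  if y' = !y then min 1 (biasW V (!y) / biasW V y) else 1 - min 1 (biasW V (!y) / biasW V y)

/-- **Exact heat bath of the biased stream at bias `V`**: an independent draw from the normalised
biased law. -/
def heatBath (V : Bool → ℕ) (y' : Bool) : ℝ := biasW V y' / (biasW V false + biasW V true)

/-! ## §2 Certificates: every elementary move is exact for its instantaneous target -/

/-- The physical law is positive. -/
theorem phys_pos (b : Bool) : 0 < phys b := by
  unfold phys; split_ifs <;> norm_num

/-- `phys false = 1/3`. -/
theorem phys_false : phys false = 1 / 3 := by simp [phys]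

/-- The physical law is normalised. -/
theorem phys_sum : phys false + phys true = 1 := by simp [phys]; norm_num

/-- `2^{V b} > 0`. -/
theorem biasExp_pos (V : Bool → ℕ) (b : Bool) : 0 < biasExp V b := by
  unfold biasExp; positivity

/-- The biased weights are positive. -/
theorem biasW_pos (V : Bool → ℕ) (b : Bool) : 0 < biasW V b :=
  div_pos (phys_pos b) (biasExp_pos V b)

/-- At zero bias the biased law is the physical law: the initial product law `phys ⊗ phys` is the
exact pair law for `V = 0`. -/
theorem biasW_noBias (b : Bool) : biasW noBias b = phys b := by simp [biasW, biasExp, noBias]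

/-- The algebra behind both detailed-balance identities: `p (q/b) min{1, b/a} = q (p/a) min{1, a/b}`
for `a, b > 0`. -/
theorem mul_div_min_symm (p q : ℝ) {a b : ℝ} (ha : 0 < a) (hb : 0 < b) :
    p * (q / b) * min 1 (b / a) = q * (p / a) * min 1 (a / b) := by
  rcases le_total a b with h | h
  · rw [min_eq_left ((one_le_div ha).2 h), min_eq_right ((div_le_one hb).2 h)]
    field_simp
  · rw [min_eq_right ((div_le_one ha).2 h), min_eq_left ((one_le_div hb).2 h)]
    field_simp

/-- `p · min{1, q/p} = min{p, q}` for `p > 0`. -/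
theorem mul_min_one_div {p : ℝ} (q : ℝ) (hp : 0 < p) : p * min 1 (q / p) = min p q := by
  rw [mul_min_of_nonneg _ _ hp.le, mul_one, mul_div_cancel₀ _ hp.ne']

/-- **The exchange is exact at every bias** (detailed balance w.r.t. `phys x · biasW V y`). -/
theorem swapK_detailedBalance (V : Bool → ℕ) (z z' : Bool × Bool) :
    phys z.1 * biasW V z.2 * swapK V z z' = phys z'.1 * biasW V z'.2 * swapK V z' z := by
  obtain ⟨x, y⟩ := z
  obtain ⟨x', y'⟩ := z'
  by_cases hswap : ((x', y') : Bool × Bool) = (x, y).swap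
  · simp only [Prod.swap_prod_mk, Prod.mk.injEq] at hswap
    obtain ⟨rfl, rfl⟩ := hswap
    by_cases hxy : x' = y'
    · subst hxy; rfl
    · have h1 : ((x', y') : Bool × Bool) ≠ (y', x') := by
        intro h
        simp only [Prod.mk.injEq] at h
        exact hxy h.1
      have h2 : ((y', x') : Bool × Bool) ≠ (x', y') := fun h => h1 h.symm
      simp only [swapK, Prod.swap_prod_mk, if_true, h1, h2, if_false, add_zero, swapAcc, biasW]
      exact mul_div_min_symm _ _ (biasExp_pos V y') (biasExp_pos V x')
  · by_cases heq : ((x', y') : Bool × Bool) = (x, y)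
    · simp only [Prod.mk.injEq] at heq
      obtain ⟨rfl, rfl⟩ := heq
      rfl
    · have h1 : ((x, y) : Bool × Bool) ≠ (x', y').swap := by
        intro h; apply hswap; rw [h, Prod.swap_swap]
      have h2 : ((x, y) : Bool × Bool) ≠ (x', y') := fun h => heq h.symm
      simp only [swapK, hswap, heq, h1, h2, if_false, add_zero, mul_zero]

/-- The exchange kernel is Markov. -/
theorem swapK_sum (V : Bool → ℕ) (z : Bool × Bool) : ∑ z', swapK V z z' = 1 := by
  obtain ⟨x, y⟩ := z
  cases x <;> cases y <;>
    simp [swapK, Fintype.sum_prod_type]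

/-- The exchange kernel is non-negative. -/
theorem swapK_nonneg (V : Bool → ℕ) (z z' : Bool × Bool) : 0 ≤ swapK V z z' := by
  unfold swapK swapAcc
  have h1 : (0 : ℝ) ≤ min 1 (biasExp V z.2 / biasExp V z.1) :=
    le_min zero_le_one (div_nonneg (biasExp_pos V z.2).le (biasExp_pos V z.1).le)
  have h2 : min 1 (biasExp V z.2 / biasExp V z.1) ≤ (1 : ℝ) := min_le_left _ _
  split_ifs <;> linarith

/-- **One Metropolis move of the biased stream is exact at every bias** (detailed balance w.r.t.
`biasW V`). -/
theorem flipMH_detailedBalance (V : Bool → ℕ) (y y' : Bool) :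
    biasW V y * flipMH V y y' = biasW V y' * flipMH V y' y := by
  by_cases h : y' = !y
  · subst h
    simp only [flipMH, if_true, Bool.not_not]
    rw [mul_min_one_div _ (biasW_pos V y), mul_min_one_div _ (biasW_pos V (!y)), min_comm]
  · have hy : y' = y := by cases y <;> cases y' <;> simp_all
    subst hy
    rfl

/-- The Metropolis move is Markov. -/
theorem flipMH_sum (V : Bool → ℕ) (y : Bool) : ∑ y', flipMH V y y' = 1 := by
  cases y <;> simp [flipMH]

/-- **The heat bath is exact at every bias** (the normalised biased law is stationary — indeed it is
drawn afresh). -/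
theorem heatBath_stationary (V : Bool → ℕ) (y' : Bool) :
    ∑ y, biasW V y * heatBath V y' = biasW V y' := by
  have hZ : biasW V false + biasW V true ≠ 0 := (add_pos (biasW_pos V false) (biasW_pos V true)).ne'
  simp only [Fintype.sum_bool, heatBath]
  field_simp
  ring

/-- The heat bath is Markov. -/
theorem heatBath_sum (V : Bool → ℕ) : ∑ y', heatBath V y' = 1 := by
  have hZ : biasW V false + biasW V true ≠ 0 := (add_pos (biasW_pos V false) (biasW_pos V true)).ne'
  simp only [Fintype.sum_bool, heatBath]
  field_simp
  ring

/-! ## §3 Witness 1: deposit → one exact Metropolis move → exchange (no re-equilibration) -/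

/-- The measurement stream's law after ONE round of «deposit at the biased stream's sector `y₀` →
one Metropolis move of the biased stream at the new bias → exchange at the new bias», started from
`phys ⊗ phys` with no bias (measurement stream frozen in between). -/
def roundMetropolis (b : Bool) : ℝ :=
  ∑ x₀, ∑ y₀, ∑ y₁, ∑ y',
    phys x₀ * phys y₀ * flipMH (deposit noBias y₀) y₀ y₁ *
      swapK (deposit noBias y₀) (x₀, y₁) (b, y')

/-- **`P(x₁ = false) = 1/2`.** -/
theorem roundMetropolis_false : roundMetropolis false = 1 / 2 := by
  simp [roundMetropolis, flipMH, swapK, swapAcc, deposit, noBias, biasW, biasExp, phys]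
  norm_num [min_def]

/-- `P(x₁ = true) = 1/2` (the law is normalised). -/
theorem roundMetropolis_true : roundMetropolis true = 1 / 2 := by
  simp [roundMetropolis, flipMH, swapK, swapAcc, deposit, noBias, biasW, biasExp, phys]
  norm_num [min_def]

/-- **WITNESS 1 — adaptive PT-MetaD with an exactly updated but not re-equilibrated biased stream is
NOT exact in the measurement stream**: after one round the measurement stream holds sector `false`
with probability `1/2`, not `phys false = 1/3`. -/
theorem witnessMetropolis : roundMetropolis false ≠ phys false := by
  rw [roundMetropolis_false, phys_false]
  norm_num

/-! ## §4 Witness 2: heat bath → deposit → exchange (the literal metadynamics order) -/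

/-- Round one of «heat-bath redraw at the current bias (none yet) → deposit at the redrawn sector `y₁` →
exchange at the new bias»: the measurement stream's law. -/
def roundOneMetaDOrder (b : Bool) : ℝ :=
  ∑ x₀, ∑ y₁, ∑ y',
    phys x₀ * heatBath noBias y₁ * swapK (deposit noBias y₁) (x₀, y₁) (b, y')

/-- Round one is still exact: `P(x₁ = false) = 1/3` (at the first exchange the fresh deposit makes the
biased stream's bias the larger one, so the exchange is accepted surely and `x₁ = y₁ ∼ phys`). -/
theorem roundOneMetaDOrder_false : roundOneMetaDOrder false = 1 / 3 := by
  simp [roundOneMetaDOrder, heatBath, swapK, swapAcc, deposit, noBias, biasW, biasExp, phys]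
  norm_num [min_def]

/-- Two rounds of the same protocol: redraw `y₁` (bias `0`) → deposit at `y₁` → exchange at `δ_{y₁}`
giving `x₁` → redraw `y₂` at bias `δ_{y₁}` → deposit at `y₂` → exchange at `δ_{y₁} + δ_{y₂}`; the
measurement stream's law of `x₂`. -/
def roundTwoMetaDOrder (b : Bool) : ℝ :=
  ∑ x₀, ∑ y₁, ∑ x₁, ∑ y₁', ∑ y₂, ∑ y₂',
    phys x₀ * heatBath noBias y₁ * swapK (deposit noBias y₁) (x₀, y₁) (x₁, y₁') *
      (heatBath (deposit noBias y₁) y₂ *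
        swapK (deposit (deposit noBias y₁) y₂) (x₁, y₂) (b, y₂'))

/-- **`P(x₂ = false) = 2/5`.** -/
theorem roundTwoMetaDOrder_false : roundTwoMetaDOrder false = 2 / 5 := by
  simp [roundTwoMetaDOrder, heatBath, swapK, swapAcc, deposit, noBias, biasW, biasExp, phys]
  norm_num [min_def]

/-- **WITNESS 2 — with the literal metadynamics order (bias updated after the equilibration and before
the exchange) even an EXACT heat bath in the biased stream does not keep the measurement stream
exact**: `P(x₂ = false) = 2/5 ≠ 1/3`. -/
theorem witnessMetaDOrder : roundTwoMetaDOrder false ≠ phys false := by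
  rw [roundTwoMetaDOrder_false, phys_false]
  norm_num

/-! ## §5 Sanity instance of the redraw theorem: deposit → heat bath → exchange stays exact -/

/-- Two rounds of «deposit at the biased stream's current sector → heat-bath redraw at the NEW bias →
exchange at that bias» (the protocol of `PTMetaDAdaptiveRedraw.lean`), from `phys ⊗ phys`, no bias. -/
def roundTwoRedrawOrder (b : Bool) : ℝ :=
  ∑ x₀, ∑ y₀, ∑ y₁, ∑ x₁, ∑ y₁', ∑ y₂, ∑ y₂',
    phys x₀ * phys y₀ * heatBath (deposit noBias y₀) y₁ *
      swapK (deposit noBias y₀) (x₀, y₁) (x₁, y₁') *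
      (heatBath (deposit (deposit noBias y₀) y₁') y₂ *
        swapK (deposit (deposit noBias y₀) y₁') (x₁, y₂) (b, y₂'))

/-- `P(x₂ = false) = 1/3 = phys false`: exact, as `PTMetaDAdaptiveRedraw.adaptiveRound_iterate`
proves in general. -/
theorem roundTwoRedrawOrder_false : roundTwoRedrawOrder false = 1 / 3 := by
  simp [roundTwoRedrawOrder, heatBath, swapK, swapAcc, deposit, noBias, biasW, biasExp, phys]
  norm_num [min_def]

end PTMetaDWitness

end Summit.Ventures.LatticeQCDFlow.Exactness

end
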